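/-
Copyright: the pub-balaban-gaps cell (G2 seat ne6, gen 7; row NE7b), for the b2b-balaban T⁴-continuum CRUX team's
row-NE7b OWNER lineage `t4-ne7b-p1` (re-cut W-ne7bp1-g103-1 ∕ -2). Released under the licence of the surrounding project.
-/
import Summits.QuantumFields.BalabanUV.T4Continuum.Spine.NE7b.PrefixExtraction
import Summits.QuantumFields.BalabanUV.T4Continuum.Spine.NE7b.PinnedExtraction

/-!
# PREFIX EXTRACTION ⟹ EXTRACTION LAWS: per-step relative event displays at the cutoff family's towers give the road's
# per-class display `PinnedExtraction.ExtractionLaws.extract` over the END's own term index and weights (row NE7b, U5c)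

Cell `pub-balaban`, sub-cell `t4`, spine estimate NE7b (`T4WeightBudget.RelWeightBound`, the cell's OWN estimate — NOT
PRINTED, NOT PROVED).  Crux-route work under `Spine/NE7b/`; no `T4Continuum/Support` leaf typed, no `Prop` of Bałaban's
minted, no `[cite:]` tag; zero `sorry`.  Imports `…NE7b.PrefixExtraction` (the prefix induction over the abstract tower) and
`…NE7b.PinnedExtraction` (the road's hypothesis shape `ExtractionLaws`, owner g103, p352727).

WHY.  Owner ruling W-ne7bp1-g103-1 (ii) names the road of record for the (α) instance per run: `PinnedExtraction.ExtractionLaws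
l₀ T A Bad X Badx q` at `T := HIndex.termSet (skelFam T p₀)`, `A := Repr172R.weight μ (reprFam …)` (IR-97-2's cutoff family of
history towers, M2-A's weights), with THE display `extract` per pinned class = IR-103-1's field `extractA` (run A; `extractB`
likewise at the cutoff-`(K+1)` tower after node O's partial summation).  `…NE7b.PrefixExtraction.sum_admS_integral_le` derives
that K-step display from ONE-STEP relative displays along a pinned PATTERN; THIS FILE is the junction in the END's own
currency: a pinned class `x ∈ X K` READ AS A PATTERN `S K x` of the cutoff-`K` tower (which next choices carry `x`'s event at
each of its steps — the R-class reading, (A1c)'s; a hypothesis shape here) has as sub-class `badx K x` the large-summand terms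
of the pattern class `admS (T K) (S K x) K`; their weights ARE the history integrals (`weight_true`), the full sum IS
`∫ ρ₀ K t dν_{K,0}` (`holdsFam` + `Repr172R.integral_eq_sum_weight` + `Tower.integral_dens_eq_of_lt`, on the source window
only), so the displays `hrel` with rates `ε K x j ≥ 0` GIVE `ExtractionLaws` with quotients `q K x := Π_{j<K} ε K x j`.

WHAT IS PROVED ([folklore]):
* §1 `histIdx` (the large-summand term of a history), `histIdx_injective`, `weight_histIdx` (= `weight_true`), `badx` (the
  pattern class as terms), `sum_badx_weight`, `histIdx_mem_termSet` (a pattern history other than the all-small one IS a term).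
* §2 `sum_termSet_weight_eq_integral` (the full sum = `∫ ρ₀ K t dν_{K,0}`, displays at ONE `(K, t)`);
  **`extract_of_prefix`** (THE DISPLAY for one cutoff, source value and pinned class from `hrel` along its pattern);
  `weight_reprFam_nonneg`; `extract_of_prefix_of_subset` (a sub-class READ INTO a pattern class inherits the display);
  **`extractionLaws_of_prefix`** (cover + `hrel` for every pinned class on the window ⟹ `ExtractionLaws` with `q = Π ε`);
  `extractionLaws_of_prefix_of_subset` (the KEYED form: arbitrary sub-classes `Badx K x ⊆ badx …`, e.g. `fibre … K k`).
* §2b `hrel_of_relaxed_step` (domination AT THE TERM by an event-CONFINED relaxed step map with factor `c` + a mass bound `D` for the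
  relaxed images ⟹ `hrel` with rate `c·D`; the pair `(c, D)` carries ONE residual «LCS-j», refuter F338 — see the docstring).
* §2c `wAlong_snoc`, `sum_admS_discounted_le`, **`sum_admS_integral_le_of_wAlong`** (HISTORY-DEPENDENT positive rates `ε j g`:
  the discounted class sum is non-increasing; the class weight is at most `q·∫ρ₀ dμ_0` for any bound `q` on the PRODUCT OF RATES
  ALONG A PATTERN HISTORY (`Tower.wAlong`) — file 1's level-uniform theorem is the case `q = Π_{j<K} ε j`).
* §3 Sanity (decided toy arithmetic on `B16HistoryReprInstance.toyT`; says nothing about Bałaban's objects): the prefix bound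
  is inhabited non-vacuously and ATTAINED (`toy_sum_admS`: class weight `15 = (3·5)·1`).

NOT HERE (honest).  The displays `hrel` for Bałaban's tower ((1.79)'s KIND in measure, NOT print's statement — see
`…NE7b.PrefixExtraction`'s header); the patterns and the cover (the R-class reading of `badGMems ∕ fibre`, (A1c)); the count
`Σ_{x ∈ X K} Π_j ε K x j ≤ V·r^{K−j⋆(K)}`; run B's bookkeeping through `trunc` (the same theorem at the cutoff-`(K+1)` tower once
IR-103-1 fixes `weightB`).  BY-NAME EFFECT ON THE WALL: IR-103-1's K-step field `extractA` becomes DERIVABLE from per-step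
displays; nothing of Bałaban's is discharged.  NE7b NOT PRINTED ∕ NOT PROVED; spine PROVED 0∕9; rung (B)+1 on a FINITE
torus — NOT infinite volume, NOT the mass gap, NOT Clay.
HONEST DEPENDENCY: continuum YM on T⁴ ⇐ BetaPertH ∧ nine spine estimates (0/9 proved); BetaPertH ⇐ (D1) ∧ (D4) ∧
CAP+tail; G-an2-4 gates asym, D1 and NE2/3/4.  This file changes none of it. -/

set_option autoImplicit false

open Finset MeasureTheory
open Summit.QuantumFields.BalabanUV.T4Continuum.B16HistoryIndexedRepr
open Summit.QuantumFields.BalabanUV.T4Continuum.B16HistoryReprChain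
open Summit.QuantumFields.BalabanUV.T4Continuum.B16HistoryReprInstance
open Summit.QuantumFields.BalabanUV.T4Continuum.NE7b.PinnedExtraction
open Summit.QuantumFields.BalabanUV.T4Continuum.NE7b.PrefixExtraction

namespace Summit.QuantumFields.BalabanUV.T4Continuum.NE7b.PrefixExtractionLaws

variable {P : Type} [DecidableEq P] {C : ℕ → ℕ → Type} {𝒢 : (K j : ℕ) → GoodClass (C K j)}
  (T : (K : ℕ) → Tower P (C K) (𝒢 K)) (p₀ : ℕ → ℕ → P)

/-! ## §1 The pattern class as terms of the cutoff skeleton's large summand -/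

section Terms

/-- **THE LARGE-SUMMAND TERM OF A HISTORY** of the cutoff-`K` tower: `⟨K, true, (h, (), ())⟩` in the K-uniform index type of
`skelFam T p₀`. [folklore] -/
def histIdx (K : ℕ) (h : Fin K → P) : HIndex.Idx (skelFam T p₀) := ⟨K, true, (h, (), ())⟩

/-- At a fixed cutoff the history ↦ term map is injective. [folklore] -/
theorem histIdx_injective (K : ℕ) : Function.Injective (histIdx T p₀ K) := by
  intro h h' e
  have e1 := eq_of_heq (Sigma.mk.inj_iff.mp e).2
  have e2 := eq_of_heq (Sigma.mk.inj_iff.mp e1).2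
  exact congrArg Prod.fst e2

/-- A history of the cutoff-`K` tower other than the all-small one IS a term of `T K` (the large summand's). [folklore] -/
theorem histIdx_mem_termSet {K : ℕ} {h : Fin K → P} (hh : h ∈ (T K).adm K) (hne : h ≠ hsmall (p₀ K) K) :
    histIdx T p₀ K h ∈ HIndex.termSet (skelFam T p₀) K := by
  refine Finset.mem_map.2 ⟨⟨true, (h, (), ())⟩, Finset.mem_sigma.2 ⟨Finset.mem_univ _, ?_⟩, rfl⟩
  show (h, (), ()) ∈ (skelFam T p₀ K).HZs true ×ˢ ((skelFam T p₀ K).HYs true ×ˢ (skelFam T p₀ K).HCs true)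
  simp only [Finset.mem_product, Finset.mem_singleton, and_true]
  show h ∈ (if true then ((T K).adm K).erase (hsmall (p₀ K) K) else {hsmall (p₀ K) K})
  rw [if_pos rfl]
  exact Finset.mem_erase.2 ⟨hne, hh⟩

variable {α : Type*} (S : (K : ℕ) → α → (j : ℕ) → (Fin j → P) → Finset P)

/-- **THE PINNED CLASS AS TERMS**: the large-summand terms of the histories in the pattern class of `S K x`. [folklore] -/
def badx (K : ℕ) (x : α) : Finset (HIndex.Idx (skelFam T p₀)) :=
  (admS (T K) (S K x) K).map ⟨histIdx T p₀ K, histIdx_injective T p₀ K⟩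

variable (ρ₀ : (K : ℕ) → ℝ → C K 0 → ℝ) (hρ : ∀ K t, (𝒢 K 0).Gd (ρ₀ K t)) (h0 : ∀ K t x, 0 ≤ ρ₀ K t x)
  (B : ℕ → ℝ → ℝ) (hB : ∀ K t, 0 < B K t) [∀ K j, MeasurableSpace (C K j)] (ν : (K j : ℕ) → Measure (C K j))

/-- **THE WEIGHT OF A HISTORY's TERM IS ITS HISTORY INTEGRAL** (`B16HistoryReprInstance.weight_true`). [folklore] -/
theorem weight_histIdx (K : ℕ) (t : ℝ) (h : Fin K → P) :
    Repr172R.weight (I := skelFam T p₀) (fun K => ν K K) (reprFam T p₀ ρ₀ hρ h0 B hB) t (histIdx T p₀ K h) =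
      ∫ x, (T K).eterm (ρ₀ K t) K h x ∂ν K K :=
  weight_true T p₀ ρ₀ hρ h0 B hB (fun K => ν K K) K t h

/-- The pinned class's partial sum of weights IS the pattern class's sum of history integrals. [folklore] -/
theorem sum_badx_weight (K : ℕ) (t : ℝ) (x : α) :
    ∑ τ ∈ badx T p₀ S K x, Repr172R.weight (I := skelFam T p₀) (fun K => ν K K) (reprFam T p₀ ρ₀ hρ h0 B hB) t τ =
      ∑ h ∈ admS (T K) (S K x) K, ∫ y, (T K).eterm (ρ₀ K t) K h y ∂ν K K := by
  unfold badx
  rw [Finset.sum_map]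
  exact Finset.sum_congr rfl fun h _ => weight_histIdx T p₀ ρ₀ hρ h0 B hB ν K t h

end Terms

/-! ## §2 The display `extract` and the extraction laws from per-step displays -/

section Laws

variable (ρ₀ : (K : ℕ) → ℝ → C K 0 → ℝ) (hρ : ∀ K t, (𝒢 K 0).Gd (ρ₀ K t)) (h0 : ∀ K t x, 0 ≤ ρ₀ K t x)
  (B : ℕ → ℝ → ℝ) (hB : ∀ K t, 0 < B K t) [∀ K j, MeasurableSpace (C K j)] (ν : (K j : ℕ) → Measure (C K j))

/-- **THE FULL SUM IS THE LEVEL-0 INTEGRAL OF THE DRESSED DENSITY**, at ONE cutoff and source value: «(1.72) holds»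
(`holdsFam`), M2-A's `integral_eq_sum_weight` and the telescoping `integral_dens_eq_of_lt` under the termwise displays at the
levels `j < K` and integrable M1-terms at level `K` (all displayed for this `(K, t)` only). [folklore] -/
theorem sum_termSet_weight_eq_integral (hp₀ : ∀ K j g, p₀ K j ∈ (T K).branch j g) (K : ℕ) (t : ℝ)
    (hint : ∀ j g, j < K → g ∈ (T K).adm j → Integrable ((T K).eterm (ρ₀ K t) j g) (ν K j))
    (hint' : ∀ j g p, j < K → g ∈ (T K).adm j → p ∈ (T K).branch j g →
      Integrable (((T K).op j g p).T ((T K).eterm (ρ₀ K t) j g)) (ν K (j + 1)))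
    (hpres : ∀ j g, j < K → g ∈ (T K).adm j →
      ∫ x, (∑ p ∈ (T K).branch j g, ((T K).op j g p).T ((T K).eterm (ρ₀ K t) j g) x) ∂ν K (j + 1) =
        ∫ x, (T K).eterm (ρ₀ K t) j g x ∂ν K j)
    (hintM : ∀ a, ∀ ι ∈ (skelFam T p₀ K).LIdx a, Integrable ((reprFam T p₀ ρ₀ hρ h0 B hB K t).eterm a ι) (ν K K)) :
    ∑ τ ∈ HIndex.termSet (skelFam T p₀) K,
        Repr172R.weight (I := skelFam T p₀) (fun K => ν K K) (reprFam T p₀ ρ₀ hρ h0 B hB) t τ =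
      ∫ U, ρ₀ K t U ∂ν K 0 := by
  rw [← Repr172R.integral_eq_sum_weight (fun K => ν K K) (reprFam T p₀ ρ₀ hρ h0 B hB) K t (densFam T ρ₀ K t)
    (holdsFam T p₀ ρ₀ hρ h0 B hB hp₀ K t) hintM]
  exact (T K).integral_dens_eq_of_lt (ν K) (ρ₀ K t) K hint hint' hpres

variable {α : Type*} (S : (K : ℕ) → α → (j : ℕ) → (Fin j → P) → Finset P) (ε : ℕ → α → ℕ → ℝ)

/-- **THE DISPLAY `extract` FOR ONE CUTOFF, SOURCE VALUE AND PINNED CLASS from per-step displays along its pattern**: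
`Σ_{τ ∈ badx K x} A t τ ≤ (Π_{j<K} ε K x j) · Σ_{τ ∈ T K} A t τ`. [folklore] -/
theorem extract_of_prefix (hp₀ : ∀ K j g, p₀ K j ∈ (T K).branch j g) (K : ℕ) (t : ℝ) (x : α)
    (hε : ∀ j, 0 ≤ ε K x j)
    (hrel : ∀ j g, j < K → g ∈ admS (T K) (S K x) j →
      ∑ p ∈ (T K).branch j g ∩ S K x j g, ∫ y, ((T K).op j g p).T ((T K).eterm (ρ₀ K t) j g) y ∂ν K (j + 1) ≤
        ε K x j * ∫ y, (T K).eterm (ρ₀ K t) j g y ∂ν K j)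
    (hint : ∀ j g, j < K → g ∈ (T K).adm j → Integrable ((T K).eterm (ρ₀ K t) j g) (ν K j))
    (hint' : ∀ j g p, j < K → g ∈ (T K).adm j → p ∈ (T K).branch j g →
      Integrable (((T K).op j g p).T ((T K).eterm (ρ₀ K t) j g)) (ν K (j + 1)))
    (hpres : ∀ j g, j < K → g ∈ (T K).adm j →
      ∫ x, (∑ p ∈ (T K).branch j g, ((T K).op j g p).T ((T K).eterm (ρ₀ K t) j g) x) ∂ν K (j + 1) =
        ∫ x, (T K).eterm (ρ₀ K t) j g x ∂ν K j)
    (hintM : ∀ a, ∀ ι ∈ (skelFam T p₀ K).LIdx a, Integrable ((reprFam T p₀ ρ₀ hρ h0 B hB K t).eterm a ι) (ν K K)) :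
    ∑ τ ∈ badx T p₀ S K x, Repr172R.weight (I := skelFam T p₀) (fun K => ν K K) (reprFam T p₀ ρ₀ hρ h0 B hB) t τ ≤
      (∏ j ∈ Finset.range K, ε K x j) *
        ∑ τ ∈ HIndex.termSet (skelFam T p₀) K,
          Repr172R.weight (I := skelFam T p₀) (fun K => ν K K) (reprFam T p₀ ρ₀ hρ h0 B hB) t τ := by
  rw [sum_badx_weight, sum_termSet_weight_eq_integral T p₀ ρ₀ hρ h0 B hB ν hp₀ K t hint hint' hpres hintM]
  exact sum_admS_integral_le (T K) (S K x) (ν K) (ρ₀ K t) (ε K x) hε K hrel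

/-- The weights of the tower's term family are non-negative (`reprFam`'s characteristic slot is `1`). [folklore] -/
theorem weight_reprFam_nonneg (t : ℝ) (τ : HIndex.Idx (skelFam T p₀)) :
    0 ≤ Repr172R.weight (I := skelFam T p₀) (fun K => ν K K) (reprFam T p₀ ρ₀ hρ h0 B hB) t τ :=
  Repr172R.weight_nonneg (fun K => ν K K) (reprFam T p₀ ρ₀ hρ h0 B hB) t (fun _ _ _ => zero_le_one) τ

/-- **THE DISPLAY FOR A SUB-CLASS READ INTO A PATTERN CLASS** (the shape an instance keyed by live genealogies uses: its
sub-class `Badx' ⊆ badx T p₀ S K x` — «every term carrying the key is the large-summand term of a history in the key's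
pattern class», the R-class READING — inherits the display with the same quotient, by non-negativity). [folklore] -/
theorem extract_of_prefix_of_subset (hp₀ : ∀ K j g, p₀ K j ∈ (T K).branch j g) (K : ℕ) (t : ℝ) (x : α)
    {Badx' : Finset (HIndex.Idx (skelFam T p₀))} (hsub : Badx' ⊆ badx T p₀ S K x) (hε : ∀ j, 0 ≤ ε K x j)
    (hrel : ∀ j g, j < K → g ∈ admS (T K) (S K x) j →
      ∑ p ∈ (T K).branch j g ∩ S K x j g, ∫ y, ((T K).op j g p).T ((T K).eterm (ρ₀ K t) j g) y ∂ν K (j + 1) ≤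
        ε K x j * ∫ y, (T K).eterm (ρ₀ K t) j g y ∂ν K j)
    (hint : ∀ j g, j < K → g ∈ (T K).adm j → Integrable ((T K).eterm (ρ₀ K t) j g) (ν K j))
    (hint' : ∀ j g p, j < K → g ∈ (T K).adm j → p ∈ (T K).branch j g →
      Integrable (((T K).op j g p).T ((T K).eterm (ρ₀ K t) j g)) (ν K (j + 1)))
    (hpres : ∀ j g, j < K → g ∈ (T K).adm j →
      ∫ x, (∑ p ∈ (T K).branch j g, ((T K).op j g p).T ((T K).eterm (ρ₀ K t) j g) x) ∂ν K (j + 1) =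
        ∫ x, (T K).eterm (ρ₀ K t) j g x ∂ν K j)
    (hintM : ∀ a, ∀ ι ∈ (skelFam T p₀ K).LIdx a, Integrable ((reprFam T p₀ ρ₀ hρ h0 B hB K t).eterm a ι) (ν K K)) :
    ∑ τ ∈ Badx', Repr172R.weight (I := skelFam T p₀) (fun K => ν K K) (reprFam T p₀ ρ₀ hρ h0 B hB) t τ ≤
      (∏ j ∈ Finset.range K, ε K x j) *
        ∑ τ ∈ HIndex.termSet (skelFam T p₀) K,
          Repr172R.weight (I := skelFam T p₀) (fun K => ν K K) (reprFam T p₀ ρ₀ hρ h0 B hB) t τ :=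
  (Finset.sum_le_sum_of_subset_of_nonneg hsub fun τ _ _ => weight_reprFam_nonneg T p₀ ρ₀ hρ h0 B hB ν t τ).trans
    (extract_of_prefix T p₀ ρ₀ hρ h0 B hB ν S ε hp₀ K t x hε hrel hint hint' hpres hintM)

/-- **EXTRACTION LAWS FOR SUB-CLASSES READ INTO PATTERNS** (the KEYED form of the road's records: arbitrary sub-classes
`Badx K x` — e.g. `fibre … K k` — covering the bad class on the source window, each READ INTO the pattern class of `S K x`,
`hread : Badx K x ⊆ badx T p₀ S K x`): non-negative rates, the per-(pinned step, pattern prefix) displays `hrel` and the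
telescoping ∕ integrability displays on the window give `PinnedExtraction.ExtractionLaws` for run A's weights with quotients
`q K x = Π_{j<K} ε K x j` (`extract_of_prefix_of_subset` per `(K, t, x)`). [folklore] -/
theorem extractionLaws_of_prefix_of_subset {l₀ : ℝ} (Bad : ℕ → ℝ → Finset (HIndex.Idx (skelFam T p₀)))
    (X : ℕ → Finset α) (Badx : ℕ → α → Finset (HIndex.Idx (skelFam T p₀)))
    (hp₀ : ∀ K j g, p₀ K j ∈ (T K).branch j g) (hε : ∀ K, ∀ x ∈ X K, ∀ j, 0 ≤ ε K x j)
    (bad_subset : ∀ K t, |t| ≤ l₀ → Bad K t ⊆ HIndex.termSet (skelFam T p₀) K)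
    (cover : ∀ K t, |t| ≤ l₀ → ∀ τ ∈ Bad K t, ∃ x ∈ X K, τ ∈ Badx K x)
    (hread : ∀ K, ∀ x ∈ X K, Badx K x ⊆ badx T p₀ S K x)
    (hrel : ∀ K t, |t| ≤ l₀ → ∀ x ∈ X K, ∀ j g, j < K → g ∈ admS (T K) (S K x) j →
      ∑ p ∈ (T K).branch j g ∩ S K x j g, ∫ y, ((T K).op j g p).T ((T K).eterm (ρ₀ K t) j g) y ∂ν K (j + 1) ≤
        ε K x j * ∫ y, (T K).eterm (ρ₀ K t) j g y ∂ν K j)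
    (hint : ∀ K t, |t| ≤ l₀ → ∀ j g, j < K → g ∈ (T K).adm j → Integrable ((T K).eterm (ρ₀ K t) j g) (ν K j))
    (hint' : ∀ K t, |t| ≤ l₀ → ∀ j g p, j < K → g ∈ (T K).adm j → p ∈ (T K).branch j g →
      Integrable (((T K).op j g p).T ((T K).eterm (ρ₀ K t) j g)) (ν K (j + 1)))
    (hpres : ∀ K t, |t| ≤ l₀ → ∀ j g, j < K → g ∈ (T K).adm j →
      ∫ x, (∑ p ∈ (T K).branch j g, ((T K).op j g p).T ((T K).eterm (ρ₀ K t) j g) x) ∂ν K (j + 1) =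
        ∫ x, (T K).eterm (ρ₀ K t) j g x ∂ν K j)
    (hintM : ∀ K t, |t| ≤ l₀ → ∀ a, ∀ ι ∈ (skelFam T p₀ K).LIdx a,
      Integrable ((reprFam T p₀ ρ₀ hρ h0 B hB K t).eterm a ι) (ν K K)) :
    ExtractionLaws l₀ (HIndex.termSet (skelFam T p₀))
      (fun _ t => Repr172R.weight (I := skelFam T p₀) (fun K => ν K K) (reprFam T p₀ ρ₀ hρ h0 B hB) t)
      Bad X Badx (fun K x => ∏ j ∈ Finset.range K, ε K x j) where
  bad_subset := bad_subset
  cover := cover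
  q_nonneg K x hx := Finset.prod_nonneg fun j _ => hε K x hx j
  extract K t ht x hx :=
    extract_of_prefix_of_subset T p₀ ρ₀ hρ h0 B hB ν S ε hp₀ K t x (hread K x hx) (hε K x hx) (hrel K t ht x hx)
      (hint K t ht) (hint' K t ht) (hpres K t ht) (hintM K t ht)

/-- **EXTRACTION LAWS FROM PER-STEP DISPLAYS** at the pattern classes themselves (`Badx := badx T p₀ S`): a bad class covered
on the source window by pinned classes read as patterns `S K x` of the cutoff-`K` tower, non-negative rates, the displays
`hrel` and the telescoping ∕ integrability displays on the window give the road's `PinnedExtraction.ExtractionLaws` for run A's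
weights with quotients `q K x = Π_{j<K} ε K x j`. [folklore] -/
theorem extractionLaws_of_prefix {l₀ : ℝ} (Bad : ℕ → ℝ → Finset (HIndex.Idx (skelFam T p₀))) (X : ℕ → Finset α)
    (hp₀ : ∀ K j g, p₀ K j ∈ (T K).branch j g) (hε : ∀ K, ∀ x ∈ X K, ∀ j, 0 ≤ ε K x j)
    (bad_subset : ∀ K t, |t| ≤ l₀ → Bad K t ⊆ HIndex.termSet (skelFam T p₀) K)
    (cover : ∀ K t, |t| ≤ l₀ → ∀ τ ∈ Bad K t, ∃ x ∈ X K, τ ∈ badx T p₀ S K x)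
    (hrel : ∀ K t, |t| ≤ l₀ → ∀ x ∈ X K, ∀ j g, j < K → g ∈ admS (T K) (S K x) j →
      ∑ p ∈ (T K).branch j g ∩ S K x j g, ∫ y, ((T K).op j g p).T ((T K).eterm (ρ₀ K t) j g) y ∂ν K (j + 1) ≤
        ε K x j * ∫ y, (T K).eterm (ρ₀ K t) j g y ∂ν K j)
    (hint : ∀ K t, |t| ≤ l₀ → ∀ j g, j < K → g ∈ (T K).adm j → Integrable ((T K).eterm (ρ₀ K t) j g) (ν K j))
    (hint' : ∀ K t, |t| ≤ l₀ → ∀ j g p, j < K → g ∈ (T K).adm j → p ∈ (T K).branch j g →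
      Integrable (((T K).op j g p).T ((T K).eterm (ρ₀ K t) j g)) (ν K (j + 1)))
    (hpres : ∀ K t, |t| ≤ l₀ → ∀ j g, j < K → g ∈ (T K).adm j →
      ∫ x, (∑ p ∈ (T K).branch j g, ((T K).op j g p).T ((T K).eterm (ρ₀ K t) j g) x) ∂ν K (j + 1) =
        ∫ x, (T K).eterm (ρ₀ K t) j g x ∂ν K j)
    (hintM : ∀ K t, |t| ≤ l₀ → ∀ a, ∀ ι ∈ (skelFam T p₀ K).LIdx a,
      Integrable ((reprFam T p₀ ρ₀ hρ h0 B hB K t).eterm a ι) (ν K K)) :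
    ExtractionLaws l₀ (HIndex.termSet (skelFam T p₀))
      (fun _ t => Repr172R.weight (I := skelFam T p₀) (fun K => ν K K) (reprFam T p₀ ρ₀ hρ h0 B hB) t)
      Bad X (badx T p₀ S) (fun K x => ∏ j ∈ Finset.range K, ε K x j) :=
  extractionLaws_of_prefix_of_subset T p₀ ρ₀ hρ h0 B hB ν S ε Bad X (badx T p₀ S) hp₀ hε bad_subset cover
    (fun _ _ _ => Finset.Subset.refl _) hrel hint hint' hpres hintM

end Laws

/-! ## §2b A supplier of the one-step display: event-CONFINED relaxation (print's (1.77)–(1.79) mechanism, one step) -/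

section Relaxed

variable {P : Type} [DecidableEq P] {C : ℕ → Type} {𝒢 : (j : ℕ) → GoodClass (C j)} {T : Tower P C 𝒢}
  {S : (j : ℕ) → (Fin j → P) → Finset P} [∀ j, MeasurableSpace (C j)] {μ : (j : ℕ) → Measure (C j)} {ρ₀ : C 0 → ℝ}

/-- **`hrel` FROM AN EVENT-CONFINED RELAXATION.**  At a pinned step `j` after the pattern prefix `g`: if the one-step image of
the history's OWN term along each pinned choice `p` is dominated pointwise by `c` times its image under a RELAXED step map
`op⁺ p` (display `hdom`, AT THE TERM), and the relaxed images along the pinned choices have total `μ_{j+1}`-mass at most `D`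
times the term's `μ_j`-mass (display `hmass`), then `hrel` holds at `(j, g)` with rate `c·D`.  The letters do NOT split as
`(c, D) = (e^{−p₀(g_j)}, 1)` (refuter π-ne7bref-g62-1, PRICING-NE7b v61 F338): extracting `c < 1` from the large-field
characteristic function against the term's density ([Balaban1989LargeFieldII] p. 383 «we estimate the factors by exp(−p₀(g_j))»,
KIND) sacrifices a part `e^{+δQ}` of the action into `op⁺`, and then `D` IS the term's localised exponential moment — the
one residual lemma «LCS-j» (local conditional stability at a pinned step: print's KIND, NOT print's statement); with `c = 1`
the plain decomposition-of-unity count gives only `D ≤ 2`.  So the confined comparison form is a CASE of §2 of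
`…NE7b.PrefixExtraction` carrying the same residual, not an alternative to it; only a relaxation at every step needs the
global comparison tower of its §4. [folklore] -/
theorem hrel_of_relaxed_step (hρ : (𝒢 0).Gd ρ₀) (h0 : ∀ x, 0 ≤ ρ₀ x) {j : ℕ} {g : Fin j → P}
    (op' : P → RelLinPosHom (𝒢 j) (𝒢 (j + 1))) {c D : ℝ} (hc : 0 ≤ c)
    (hdom : ∀ p ∈ T.branch j g ∩ S j g, ∀ x,
      (T.op j g p).T (T.eterm ρ₀ j g) x ≤ c * (op' p).T (T.eterm ρ₀ j g) x)
    (hint : ∀ p ∈ T.branch j g ∩ S j g, Integrable ((op' p).T (T.eterm ρ₀ j g)) (μ (j + 1)))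
    (hmass : ∑ p ∈ T.branch j g ∩ S j g, ∫ x, (op' p).T (T.eterm ρ₀ j g) x ∂μ (j + 1) ≤
      D * ∫ x, T.eterm ρ₀ j g x ∂μ j) :
    ∑ p ∈ T.branch j g ∩ S j g, ∫ x, (T.op j g p).T (T.eterm ρ₀ j g) x ∂μ (j + 1) ≤
      c * D * ∫ x, T.eterm ρ₀ j g x ∂μ j := by
  have hg : (𝒢 j).Gd (T.eterm ρ₀ j g) := T.eterm_good hρ j g
  calc ∑ p ∈ T.branch j g ∩ S j g, ∫ x, (T.op j g p).T (T.eterm ρ₀ j g) x ∂μ (j + 1)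
      ≤ ∑ p ∈ T.branch j g ∩ S j g, ∫ x, c * (op' p).T (T.eterm ρ₀ j g) x ∂μ (j + 1) :=
        Finset.sum_le_sum fun p hp =>
          integral_mono_of_nonneg
            (Filter.Eventually.of_forall fun x => (T.op j g p).apply_nonneg hg (T.eterm_nonneg hρ h0 j g) x)
            ((hint p hp).const_mul c) (Filter.Eventually.of_forall (hdom p hp))
    _ = c * ∑ p ∈ T.branch j g ∩ S j g, ∫ x, (op' p).T (T.eterm ρ₀ j g) x ∂μ (j + 1) := by
        rw [Finset.mul_sum]
        exact Finset.sum_congr rfl fun p _ => integral_const_mul _ _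
    _ ≤ c * (D * ∫ x, T.eterm ρ₀ j g x ∂μ j) := mul_le_mul_of_nonneg_left hmass hc
    _ = c * D * ∫ x, T.eterm ρ₀ j g x ∂μ j := by ring

end Relaxed

/-! ## §2c History-DEPENDENT rates: the quotient is the largest product of rates along a pattern history -/

section Dependent

variable {P : Type} [DecidableEq P] {C : ℕ → Type} {𝒢 : (j : ℕ) → GoodClass (C j)} (T : Tower P C 𝒢)
  (S : (j : ℕ) → (Fin j → P) → Finset P) [∀ j, MeasurableSpace (C j)] (μ : (j : ℕ) → Measure (C j)) (ρ₀ : C 0 → ℝ)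
  (ε : (j : ℕ) → (Fin j → P) → ℝ)

omit [DecidableEq P] in
/-- The product of factors along an appended history: `wAlong (K+1) (g, p) = wAlong K g · w K g p`. [folklore] -/
theorem wAlong_snoc (w : (j : ℕ) → (Fin j → P) → P → ℝ) (K : ℕ) (g : Fin K → P) (p : P) :
    Tower.wAlong w (K + 1) (Fin.snoc g p) = Tower.wAlong w K g * w K g p := by
  simp [Tower.wAlong, Fin.init_snoc, Fin.snoc_last]

/-- **THE DISCOUNTED CLASS SUM DOES NOT INCREASE.**  With POSITIVE rates `ε j g` that may depend on the pattern prefix, the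
one-step displays `hrel` make `Σ_{g ∈ admS m} (Π_{j<m} ε j (g|_j))⁻¹ · ∫ eterm m g dμ_m` non-increasing in `m ≤ K`; at
`m = 0` it is `∫ ρ₀ dμ_0`. [folklore] -/
theorem sum_admS_discounted_le (hε : ∀ j g, 0 < ε j g) :
    ∀ K, (∀ j g, j < K → g ∈ admS T S j →
        ∑ p ∈ T.branch j g ∩ S j g, ∫ x, (T.op j g p).T (T.eterm ρ₀ j g) x ∂μ (j + 1) ≤
          ε j g * ∫ x, T.eterm ρ₀ j g x ∂μ j) →
      ∑ h ∈ admS T S K, (Tower.wAlong (fun j g _ => ε j g) K h)⁻¹ * ∫ x, T.eterm ρ₀ K h x ∂μ K ≤ ∫ x, ρ₀ x ∂μ 0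
  | 0, _ => by
      show ∑ h ∈ (Finset.univ : Finset (Fin 0 → P)), (1 : ℝ)⁻¹ * ∫ x, ρ₀ x ∂μ 0 ≤ _
      rw [Finset.univ_unique, Finset.sum_singleton, inv_one, one_mul]
  | K + 1, hrel => by
      rw [sum_admS_succ]
      refine le_trans ?_ (sum_admS_discounted_le hε K fun j g hj => hrel j g (Nat.lt_succ_of_lt hj))
      refine Finset.sum_le_sum fun g hg => ?_
      have hw0 : 0 ≤ (Tower.wAlong (fun j g _ => ε j g) K g)⁻¹ :=
        inv_nonneg.2 (Tower.wAlong_nonneg _ (fun j g _ => (hε j g).le) K g)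
      have e : ∀ p ∈ T.branch K g ∩ S K g,
          (Tower.wAlong (fun j g _ => ε j g) (K + 1) (Fin.snoc g p))⁻¹ *
              ∫ x, T.eterm ρ₀ (K + 1) (Fin.snoc g p) x ∂μ (K + 1) =
            (Tower.wAlong (fun j g _ => ε j g) K g)⁻¹ * (ε K g)⁻¹ *
              ∫ x, (T.op K g p).T (T.eterm ρ₀ K g) x ∂μ (K + 1) := fun p _ => by
        rw [wAlong_snoc, eterm_snoc, mul_inv]
      rw [Finset.sum_congr rfl e, ← Finset.mul_sum]
      calc (Tower.wAlong (fun j g _ => ε j g) K g)⁻¹ * (ε K g)⁻¹ *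
            ∑ p ∈ T.branch K g ∩ S K g, ∫ x, (T.op K g p).T (T.eterm ρ₀ K g) x ∂μ (K + 1)
          ≤ (Tower.wAlong (fun j g _ => ε j g) K g)⁻¹ * (ε K g)⁻¹ * (ε K g * ∫ x, T.eterm ρ₀ K g x ∂μ K) :=
            mul_le_mul_of_nonneg_left (hrel K g K.lt_succ_self hg) (mul_nonneg hw0 (inv_nonneg.2 (hε K g).le))
        _ = (Tower.wAlong (fun j g _ => ε j g) K g)⁻¹ * ∫ x, T.eterm ρ₀ K g x ∂μ K := by
            rw [mul_assoc, ← mul_assoc (ε K g)⁻¹, inv_mul_cancel₀ (hε K g).ne', one_mul]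

/-- **THE PREFIX INDUCTION WITH HISTORY-DEPENDENT RATES.**  Positive one-step rates `ε j g` depending on the pattern prefix
(e.g. a renewal's cost read off the component's CURRENT geometry), the displays `hrel`, a non-negative good `ρ₀`, and a bound
`q` on the product of rates along every pattern history of length `K` give `Σ_{h ∈ admS K} ∫ eterm K h dμ_K ≤ q · ∫ ρ₀ dμ_0`
— the quotient is the LARGEST PRODUCT OF RATES ALONG A PATTERN HISTORY (`Tower.wAlong`), the same shape as the comparison
reading's `hq` in `…NE7b.PrefixExtraction.sum_admS_integral_le_mul_sum_comparison`; `…sum_admS_integral_le` is the case of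
level-uniform rates (`q = Π_{j<K} ε j`). [folklore] -/
theorem sum_admS_integral_le_of_wAlong (hρ : (𝒢 0).Gd ρ₀) (h0 : ∀ x, 0 ≤ ρ₀ x) (hε : ∀ j g, 0 < ε j g) (K : ℕ)
    (hrel : ∀ j g, j < K → g ∈ admS T S j →
      ∑ p ∈ T.branch j g ∩ S j g, ∫ x, (T.op j g p).T (T.eterm ρ₀ j g) x ∂μ (j + 1) ≤
        ε j g * ∫ x, T.eterm ρ₀ j g x ∂μ j)
    {q : ℝ} (hq0 : 0 ≤ q) (hq : ∀ h ∈ admS T S K, Tower.wAlong (fun j g _ => ε j g) K h ≤ q) :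
    ∑ h ∈ admS T S K, ∫ x, T.eterm ρ₀ K h x ∂μ K ≤ q * ∫ x, ρ₀ x ∂μ 0 := by
  have hwpos : ∀ (m : ℕ) (h : Fin m → P), 0 < Tower.wAlong (fun j g _ => ε j g) m h := by
    intro m
    induction m with
    | zero => intro h; exact one_pos
    | succ m ih => intro h; exact mul_pos (ih (Fin.init h)) (hε m (Fin.init h))
  have hD : ∀ h ∈ admS T S K, 0 ≤ (Tower.wAlong (fun j g _ => ε j g) K h)⁻¹ * ∫ x, T.eterm ρ₀ K h x ∂μ K :=
    fun h _ => mul_nonneg (inv_nonneg.2 (hwpos K h).le) (integral_nonneg fun x => T.eterm_nonneg hρ h0 K h x)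
  calc ∑ h ∈ admS T S K, ∫ x, T.eterm ρ₀ K h x ∂μ K
      = ∑ h ∈ admS T S K, Tower.wAlong (fun j g _ => ε j g) K h *
          ((Tower.wAlong (fun j g _ => ε j g) K h)⁻¹ * ∫ x, T.eterm ρ₀ K h x ∂μ K) :=
        Finset.sum_congr rfl fun h _ => by rw [← mul_assoc, mul_inv_cancel₀ (hwpos K h).ne', one_mul]
    _ ≤ ∑ h ∈ admS T S K, q * ((Tower.wAlong (fun j g _ => ε j g) K h)⁻¹ * ∫ x, T.eterm ρ₀ K h x ∂μ K) :=
        Finset.sum_le_sum fun h hh => mul_le_mul_of_nonneg_right (hq h hh) (hD h hh)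
    _ = q * ∑ h ∈ admS T S K, (Tower.wAlong (fun j g _ => ε j g) K h)⁻¹ * ∫ x, T.eterm ρ₀ K h x ∂μ K :=
        (Finset.mul_sum _ _ _).symm
    _ ≤ q * ∫ x, ρ₀ x ∂μ 0 := mul_le_mul_of_nonneg_left (sum_admS_discounted_le T S μ ρ₀ ε hε K hrel) hq0

end Dependent

/-! ## §3 Sanity (decided toy arithmetic; says NOTHING about Bałaban's objects): on `B16HistoryReprInstance.toyT` (one-point
levels; `true ↦ ×2`, `false ↦ ×3`; `ρ₀ ≡ 1`, `ρ_2 ≡ 25`) pin step `0` to `false`: class `{(false,true),(false,false)}`, weight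
`2·3 + 3·3 = 15`; rates `ε 0 = 3` (pinned), `ε 1 = 5` (free step `2 + 3`); the bound `15 ≤ (3·5)·1` is ATTAINED. -/

section Sanity

/-- toy pattern: step `0` pinned to the choice `false`, step `1` free. [folklore] -/
def toyS : (j : ℕ) → (Fin j → Bool) → Finset Bool := fun j _ => if j = 0 then {false} else Finset.univ
/-- (S1) the pattern class's weight at level `2` is `2·3 + 3·3 = 15` (KERNEL-DECIDED). [folklore] -/
theorem toy_sum_admS : ∑ h ∈ admS toyT toyS 2, toyT.eterm (fun _ => (1 : ℝ)) 2 h () = 15 := by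
  rw [sum_admS_succ, sum_admS_succ]
  simp only [eterm_snoc]
  simp [admS, toyS, toyT, toyOps, toyOp, Tower.eterm]
  norm_num

/-- (S2) THE PREFIX BOUND ON THE TOY, NON-VACUOUSLY (levels measured by the Dirac mass at the point): the displays hold with
`ε = (3, 5, …)` and `sum_admS_integral_le` yields `15 ≤ 3·5·1` — ATTAINED, by (S1). [folklore] -/
example : ∑ h ∈ admS toyT toyS 2, ∫ x, toyT.eterm (fun _ => (1 : ℝ)) 2 h x ∂(Measure.dirac ()) ≤
    (∏ j ∈ Finset.range 2, (fun j => if j = 0 then (3 : ℝ) else 5) j) * ∫ x, (fun _ => (1 : ℝ)) x ∂(Measure.dirac ()) := by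
  refine sum_admS_integral_le toyT toyS (fun _ => Measure.dirac ()) (fun _ => (1 : ℝ)) _ (fun j => ?_) 2 ?_
  · show (0 : ℝ) ≤ if j = 0 then 3 else 5
    split_ifs <;> norm_num
  · intro j g hj _
    interval_cases j
    · simp [toyS, toyT, toyOps, toyOp, Tower.eterm] -- the pinned step: `3·1 ≤ 3·1`
    · simp [toyS, toyT, toyOps, toyOp] -- the free step: `(2 + 3)·X ≤ 5·X`
      linarith

end Sanity

end Summit.QuantumFields.BalabanUV.T4Continuum.NE7b.PrefixExtractionLaws
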